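import Summits.KontsevichZagierPeriods.KontsevichZagierPeriods.Theses.HermiteRigidity
import Summits.KontsevichZagierPeriods.KontsevichZagierPeriods.Theorems.HermiteRigidityAssembly
import Summits.KontsevichZagierPeriods.KontsevichZagierPeriods.Theorems.HermiteRigidityReductionRigidityOfKernelForm
import Summits.KontsevichZagierPeriods.KontsevichZagierPeriods.Theorems.HermiteRigidityGenusTwoCycleTransfer
import Literature.NumberTheory.Transcendental.KZKernelConjectureForms

/-!
# KontsevichZagierPeriods / HermiteRigidity — the strength of `EllipticSectorComplement` (stmt-KontsevichZagierPeriods-14724)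

Route `KontsevichZagierPeriods/HermiteRigidity`, support item stmt-KontsevichZagierPeriods-14724
(`EllipticSectorComplement`, rank 9, the "complement of the sectors" glue):

  `GenusTwoCycleTransfer → EllipticMomentKernel → RealEllipticSectorKernel → ReductionRigidity`.

This file does NOT settle the item. It certifies, with kernel-checked theorems importable from the
tree (the same content as §1/§1b of the refuters' workfile `Cruxes/ReductionRigidity/Disproof.lean`,
which is not importable under `Theorems/`), exactly how strong the item is:

* `reductionRigidity_iff_kontsevichZagierPeriods` : the conclusion `ReductionRigidity` (the route's
  rank-0 target) is EQUIVALENT to the summit statement `KontsevichZagierPeriods` — "⇒" is the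
  route's deciding theorem `closes` fed with the landed `RigidKernel.rigidKernel_proof`, "⇐" is the
  landed `ReductionRigidityOfKernelForm.reductionRigidityOfKernelForm_proof` after the Literature
  comparison `kzKernelConjecture_iff_isRational` (two-representation form ⇒ kernel form).
* `ellipticSectorComplement_iff` : UNCONDITIONALLY,
  `EllipticSectorComplement ↔ (EllipticMomentKernel → RealEllipticSectorKernel → KontsevichZagierPeriods)`
  (the first antecedent `GenusTwoCycleTransfer` is the landed theorem
  `GenusTwoCycleTransfer.GenusTwoCycleTransfer_proof`, hence idle).
* `ellipticSectorComplement_of_kernelForm` : the kernel form of Conjecture 1 implies the item (the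
  discharge hook, through the landed `ReductionRigidityOfKernelForm`);
  `ellipticSectorComplement_of_kontsevichZagierPeriods` : the summit implies the item;
  `kontsevichZagierPeriods_of_ellipticSectorComplement` : the item together with the two sector
  cruxes implies the summit; `ellipticSectorComplement_iff_kontsevichZagierPeriods` : modulo the two
  sector cruxes (open items stmt-KontsevichZagierPeriods-10631/10632, both carrying their rigidity
  hypotheses inlined, both expected theorems) the item IS the summit.

Consequently a proof of the item is a proof of Kontsevich–Zagier's Conjecture 1 (as fixed in
`Literature.NumberTheory.Transcendental.KZCalculus`) from two of its elliptic instances, and a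
refutation of the item is a refutation of the summit (an additive invariant of `KZ.FormalRep`
killing the four move sets and separating two equal-valued rational representations; none is
known). The item is open-problem strength, as its docstring in the route file says.

References: M. Kontsevich, D. Zagier, *Periods* (2001), §1.2, Conjecture 1; A. Huber,
S. Müller-Stach, *Periods and Nori Motives* (2017), §13.1–13.2.
-/

noncomputable section

namespace Summit.KontsevichZagierPeriods.HermiteRigidity.EllipticSectorComplement

open Literature.NumberTheory.Transcendental
open Summit.KontsevichZagierPeriods.KontsevichZagierPeriods.Theses.HermiteRigidity

/-- **Summit ⇒ kernel form.** The summit statement (two rational-shape representations of equal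
value are KZ-equivalent) gives the kernel form of Conjecture 1: every formal `ℤ`-combination of
integral representations of value `0` is a relation (`kzKernelConjecture_iff_isRational`).
[Kontsevich–Zagier 2001, §1.2, Conjecture 1; Huber–Müller-Stach 2017, Conj. 13.2.1] [folklore] -/
theorem kernelForm_of_kontsevichZagierPeriods (hS : _root_.KontsevichZagierPeriods) :
    ∀ c : KZ.FormalRep, KZ.eval c = 0 → c ∈ KZ.relations :=
  fun c hc => kzKernelConjecture_iff_isRational.mpr hS c hc

/-- **Summit ⇒ `ReductionRigidity`**: through the kernel form and the landed glue
`ReductionRigidityOfKernelForm` (Hamel-type choice of a maximal real-algebraically independent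
subfamily of all values). [Kontsevich–Zagier 2001, §1.2] [folklore] -/
theorem reductionRigidity_of_kontsevichZagierPeriods (hS : _root_.KontsevichZagierPeriods) :
    Summit.KontsevichZagierPeriods.KontsevichZagierPeriods.Theses.HermiteRigidity.ReductionRigidity :=
  Summit.KontsevichZagierPeriods.HermiteRigidity.ReductionRigidityOfKernelForm.reductionRigidityOfKernelForm_proof
    (kernelForm_of_kontsevichZagierPeriods hS)

/-- **`ReductionRigidity` ⇒ summit**, unconditionally: the route's deciding theorem `closes` fed
with the landed support `RigidKernel.rigidKernel_proof`. [Kontsevich–Zagier 2001, §1.2] [folklore] -/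
theorem kontsevichZagierPeriods_of_reductionRigidity
    (hX : Summit.KontsevichZagierPeriods.KontsevichZagierPeriods.Theses.HermiteRigidity.ReductionRigidity) :
    _root_.KontsevichZagierPeriods :=
  -- the closed route's deciding theorem `closes` is gone from the route file; the landed assembly
  -- `Assembly.assembly_proof : ReductionRigidity → KontsevichZagierPeriods` is `closes` + `RigidKernel`
  (id Summit.KontsevichZagierPeriods.HermiteRigidity.Assembly.assembly_proof :
    Summit.KontsevichZagierPeriods.KontsevichZagierPeriods.Theses.HermiteRigidity.ReductionRigidity →
      _root_.KontsevichZagierPeriods) hX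

/-- **The route's rank-0 target is literally equivalent to the summit** (as typed in the tree).
[Kontsevich–Zagier 2001, §1.2, Conjecture 1] [folklore] -/
theorem reductionRigidity_iff_kontsevichZagierPeriods :
    Summit.KontsevichZagierPeriods.KontsevichZagierPeriods.Theses.HermiteRigidity.ReductionRigidity ↔
      _root_.KontsevichZagierPeriods :=
  ⟨kontsevichZagierPeriods_of_reductionRigidity, reductionRigidity_of_kontsevichZagierPeriods⟩

/-- **Kernel form ⇒ item** (the discharge hook: a proof of the kernel form of Conjecture 1 on any
structural route closes this item in one line through the landed `ReductionRigidityOfKernelForm`;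
the three antecedents are not used). [Kontsevich–Zagier 2001, §1.2] [folklore] -/
theorem ellipticSectorComplement_of_kernelForm
    (hK : ∀ c : KZ.FormalRep, KZ.eval c = 0 → c ∈ KZ.relations) :
    Summit.KontsevichZagierPeriods.KontsevichZagierPeriods.Theses.HermiteRigidity.EllipticSectorComplement :=
  fun _ _ _ =>
    Summit.KontsevichZagierPeriods.HermiteRigidity.ReductionRigidityOfKernelForm.reductionRigidityOfKernelForm_proof
      hK

/-- **Summit ⇒ item**: `KontsevichZagierPeriods → EllipticSectorComplement` (the three antecedents
are not even used). [Kontsevich–Zagier 2001, §1.2] [folklore] -/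
theorem ellipticSectorComplement_of_kontsevichZagierPeriods (hS : _root_.KontsevichZagierPeriods) :
    Summit.KontsevichZagierPeriods.KontsevichZagierPeriods.Theses.HermiteRigidity.EllipticSectorComplement :=
  ellipticSectorComplement_of_kernelForm (kernelForm_of_kontsevichZagierPeriods hS)

/-- **Item + the two sector cruxes ⇒ summit**: feed the item with the landed
`GenusTwoCycleTransfer_proof` and the two sector hypotheses, then apply `closes`.
[Kontsevich–Zagier 2001, §1.2] [folklore] -/
theorem kontsevichZagierPeriods_of_ellipticSectorComplement
    (h₃ : Summit.KontsevichZagierPeriods.KontsevichZagierPeriods.Theses.HermiteRigidity.EllipticMomentKernel)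
    (h₄ : Summit.KontsevichZagierPeriods.KontsevichZagierPeriods.Theses.HermiteRigidity.RealEllipticSectorKernel)
    (hC : Summit.KontsevichZagierPeriods.KontsevichZagierPeriods.Theses.HermiteRigidity.EllipticSectorComplement) :
    _root_.KontsevichZagierPeriods :=
  kontsevichZagierPeriods_of_reductionRigidity
    (hC Summit.KontsevichZagierPeriods.HermiteRigidity.GenusTwoCycleTransfer.GenusTwoCycleTransfer_proof h₃ h₄)

/-- **Modulo the two sector cruxes, the item IS the summit**:
`EllipticMomentKernel → RealEllipticSectorKernel → (EllipticSectorComplement ↔ KontsevichZagierPeriods)`.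
[Kontsevich–Zagier 2001, §1.2, Conjecture 1] [folklore] -/
theorem ellipticSectorComplement_iff_kontsevichZagierPeriods
    (h₃ : Summit.KontsevichZagierPeriods.KontsevichZagierPeriods.Theses.HermiteRigidity.EllipticMomentKernel)
    (h₄ : Summit.KontsevichZagierPeriods.KontsevichZagierPeriods.Theses.HermiteRigidity.RealEllipticSectorKernel) :
    Summit.KontsevichZagierPeriods.KontsevichZagierPeriods.Theses.HermiteRigidity.EllipticSectorComplement ↔
      _root_.KontsevichZagierPeriods :=
  ⟨kontsevichZagierPeriods_of_ellipticSectorComplement h₃ h₄,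
    ellipticSectorComplement_of_kontsevichZagierPeriods⟩

/-- **Unconditional normal form of the item**: `EllipticSectorComplement` is equivalent to
"the two elliptic sector cruxes imply the summit",
`EllipticSectorComplement ↔ (EllipticMomentKernel → RealEllipticSectorKernel → KontsevichZagierPeriods)`;
the proved antecedent `GenusTwoCycleTransfer` is idle. [Kontsevich–Zagier 2001, §1.2, Conjecture 1]
[folklore] -/
theorem ellipticSectorComplement_iff :
    Summit.KontsevichZagierPeriods.KontsevichZagierPeriods.Theses.HermiteRigidity.EllipticSectorComplement ↔
      (Summit.KontsevichZagierPeriods.KontsevichZagierPeriods.Theses.HermiteRigidity.EllipticMomentKernel →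
        Summit.KontsevichZagierPeriods.KontsevichZagierPeriods.Theses.HermiteRigidity.RealEllipticSectorKernel →
          _root_.KontsevichZagierPeriods) :=
  ⟨fun hC h₃ h₄ => kontsevichZagierPeriods_of_ellipticSectorComplement h₃ h₄ hC,
    fun h _ h₃ h₄ => reductionRigidity_of_kontsevichZagierPeriods (h h₃ h₄)⟩

end Summit.KontsevichZagierPeriods.HermiteRigidity.EllipticSectorComplement
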